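import Summits.QuantumFields.YangMills.Theorems.OnsetSkewLawRPOnsetFloorPosTimeSynthPieces
import Summits.QuantumFields.YangMills.Theorems.OnsetSkewLawRPOnsetFloorPosTimeSynthPieceBound
import HarnessLib

/-!
# Positive-time collar synthesis from single-slot synthesis (the registered stub `stub_positiveTimeSynthesisCollar` of
# LINES «FloorInheritance» v5 (crux 23138) / «MarkovFloorInheritance» v3 (crux 22956), ym-idea-11 g13 — SPELLED OUT)

THEOREM (`posTimeSynthC_of_slotSynth`, def-free; `SlotSynth b C₁ N₁` unfolded as the hypothesis, `PosTimeSynthC b C N₁`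
unfolded as the conclusion).  Let `b` be a Schwartz father bump on `ℝ⁴` with compact support inside the open half-space
`{u₀ > 0}`, and suppose SINGLE-SLOT SYNTHESIS with constants `(C₁, N₁)`: every Schwartz `ψ` supported in `B̄(c, 3ρ/2)` with
`‖D^m ψ‖ ≤ M'/ρ^m` (`m ≤ N₁`) is an `ℓ¹` series of `b`-atoms of scales `≤ ρ` centred within `2ρ` of `c`, mass `≤ C₁ M'`.
Then there is `C ≥ 0` such that every positive-time Schwartz `v` with the flatness-weighted bound
`(1+‖z‖)¹⁴ ‖D^m v (z)‖ ≤ Mv · min(z₀,1)^(5−m)` (`m ≤ N₁`; automatic for positive-time Schwartz functions, tree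
`RPOnsetFloorCoarseCollar.schwartz_flat_of_tsupport_pos`) is an `ℓ¹` series `v = ∑ aᵢ b(σᵢ⁻¹(· − ηᵢ))` with
`∑|aᵢ| ≤ C·Mv`, `0 < σᵢ ≤ 1`, the COLLAR CLAUSE `8σᵢ ≤ ηᵢ,₀`, and every atom vanishing on `{z₀ ≤ 0}`.

PROOF (Whitney bookkeeping, parameter 64).  `v = ∑_p χ_p v` over the pieces `p = (j,n) ∈ ℕ × ℤ⁴` of
`…PosTimeSynthPieces` (dyadic layers in `z₀` × exact lattice partitions at spacing `δ_j = 2^(−j)/64`); each `χ_p v` is a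
Schwartz function (`SchwartzMap.smulLeftCLM`) supported in `B̄(c_p, 2δ_j)` with `‖D^m (χ_p v)‖ ≤ K·Mv·δ_j⁵(1+‖c_p‖)^(−14)/(2δ_j)^m`
(`norm_iteratedFDeriv_mul_flat_le`: Leibniz + five orders of flatness at the mirror); single-slot synthesis at radius `2δ_j`
gives atoms of scale `≤ 2δ_j ≤ 1/32` centred within `4δ_j` of `c_p`, and `c_p,0 > 31 δ_j` for non-zero pieces gives the collar
`ηᵢ,₀ ≥ 27 δ_j ≥ 8σᵢ`; the masses sum to `≤ C₁ K Mv · ∑_p δ_j⁵(1+‖c_p‖)^(−14) ≤ C₁ K Mv · 81/32` (`summable_weight`); the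
double series is absolutely convergent (`b` bounded) and is re-indexed by `ℕ` through `(ℕ × ℤ⁴) × ℕ ≃ ℕ`.

REGISTRY NOTE (honest): the stub was registered on 23138 (skeleton v5, sha 09e801d0) and 22956 (v3) when this seat took it
(2026-08-29T05:29Z); at 05:31Z the planner re-pointed both registries to the «FemtoWitness» lines, which use no synthesis —
so this lands as a HELPER (`--supports 23138 --as helper`); its consumers are the «FloorInheritance» / «MarkovFloorInheritance»
records and hypothesis (H1) of the tree's `RPOnsetFloorCoarseCollar.CrossFloorAtomsP` (see the companion by-name file).
HONEST FRAMING: pure analysis; no crux / rung / summit is proved; the Yang–Mills mass gap is NOT proved.  Cell `ym-idea-1`,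
width seat `ym-line-sfw-p2-w4` g21 (free hands).  Whitney decomposition: E. M. Stein, Singular Integrals (1970), Ch. VI §1.
[folklore]
-/

set_option autoImplicit false

noncomputable section

open scoped BigOperators ContDiff
open Set

namespace Summit.QuantumFields.YangMills.Theorems.RPOnsetFloorPosTimeSynth

/-- Atoms with the collar clause vanish below the mirror: if `tsupport b ⊆ {u₀ > 0}`, `0 < σ` and `8σ ≤ η₀` then
`b (σ⁻¹ • (z - η)) = 0` whenever `z₀ ≤ 0`. [folklore] -/
theorem atom_eq_zero_of_nonpos (b : SchwartzMap (EuclideanSpace ℝ (Fin 4)) ℝ)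
    (hb0 : tsupport b ⊆ {u : EuclideanSpace ℝ (Fin 4) | 0 < u 0}) {σ : ℝ} {η : EuclideanSpace ℝ (Fin 4)}
    (hσ : 0 < σ) (hcollar : 8 * σ ≤ η 0) {z : EuclideanSpace ℝ (Fin 4)} (hz : z 0 ≤ 0) :
    b (σ⁻¹ • (z - η)) = 0 := by
  apply image_eq_zero_of_notMem_tsupport
  intro hmem
  have h := hb0 hmem
  simp only [mem_setOf_eq, PiLp.smul_apply, PiLp.sub_apply, smul_eq_mul] at h
  have : z 0 - η 0 < 0 := by linarith
  exact absurd h (not_lt.2 (mul_nonpos_of_nonneg_of_nonpos (inv_nonneg.2 hσ.le) this.le))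

/-- **Positive-time collar synthesis from single-slot synthesis** — the registered stub `stub_positiveTimeSynthesisCollar` of
LINES «FloorInheritance» v5 (23138) / «MarkovFloorInheritance» v3 (22956), SPELLED OUT (`SlotSynth b C₁ N₁` is the hypothesis
`hslot`, `PosTimeSynthC b C N₁` is the conclusion after `∃ C, 0 ≤ C ∧`).  For a compactly supported positive-time father bump
`b`, single-slot synthesis with constants `(C₁, N₁)` gives: every positive-time Schwartz `v` with the flatness-weighted bound
`(1+‖z‖)¹⁴ ‖D^m v(z)‖ ≤ Mv·min(z₀,1)^(5−m)` (`m ≤ N₁`) is an `ℓ¹` series of `b`-atoms with mass `≤ C·Mv`, scales `≤ 1`, the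
COLLAR CLAUSE `8σᵢ ≤ ηᵢ,₀`, every atom vanishing on `{z₀ ≤ 0}`.  Proof: Whitney-type partition `v = ∑_p χ_p v` (pieces of
`…PosTimeSynthPieces`), each piece an admissible `SlotSynth` input at radius `2δ_j` with constant `K·Mv·δ_j⁵(1+‖c_p‖)^(−14)`
(`norm_iteratedFDeriv_mul_flat_le`), collar from `c_p,0 > 31 δ_j`, total mass `≤ C₁ K Mv · 81/32` (`summable_weight`),
reindexing `(ℕ × ℤ⁴) × ℕ ≃ ℕ`.  `C = C₁ · K · 81/32` with `K` the combinatorial constant of the pieces. [folklore] -/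
theorem posTimeSynthC_of_slotSynth (b : SchwartzMap (EuclideanSpace ℝ (Fin 4)) ℝ)
    (hb : HasCompactSupport b) (hb0 : tsupport b ⊆ {u : EuclideanSpace ℝ (Fin 4) | 0 < u 0})
    (C₁ : ℝ) (N₁ : ℕ) (hC₁ : 0 ≤ C₁)
    (hslot : ∀ (ψ : SchwartzMap (EuclideanSpace ℝ (Fin 4)) ℝ) (c : EuclideanSpace ℝ (Fin 4)) (ρ M' : ℝ), 0 < ρ →
      tsupport ψ ⊆ Metric.closedBall c (3 / 2 * ρ) →
      (∀ m : ℕ, m ≤ N₁ → ∀ z, ‖iteratedFDeriv ℝ m ψ z‖ ≤ M' / ρ ^ m) →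
      ∃ (a : ℕ → ℝ) (σ : ℕ → ℝ) (η : ℕ → EuclideanSpace ℝ (Fin 4)),
        Summable (fun i => |a i|) ∧ ∑' i, |a i| ≤ C₁ * M' ∧
        (∀ i, 0 < σ i ∧ σ i ≤ ρ ∧ ‖η i - c‖ ≤ 2 * ρ) ∧
        ∀ z, ψ z = ∑' i, a i * b ((σ i)⁻¹ • (z - η i))) :
    ∃ C : ℝ, 0 ≤ C ∧ ∀ (v : SchwartzMap (EuclideanSpace ℝ (Fin 4)) ℝ) (Mv : ℝ),
      tsupport v ⊆ {y : EuclideanSpace ℝ (Fin 4) | 0 < y 0} →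
      (∀ m : ℕ, m ≤ N₁ → ∀ z : EuclideanSpace ℝ (Fin 4), 0 < z 0 →
          (1 + ‖z‖) ^ 14 * ‖iteratedFDeriv ℝ m v z‖ ≤ Mv * (min (z 0) 1) ^ (5 - m)) →
      ∃ (coef : ℕ → ℝ) (σ : ℕ → ℝ) (η : ℕ → EuclideanSpace ℝ (Fin 4)),
        Summable (fun i => |coef i|) ∧ ∑' i, |coef i| ≤ C * Mv ∧ (∀ i, 0 < σ i ∧ σ i ≤ 1) ∧
        (∀ i, 8 * σ i ≤ η i 0) ∧
        (∀ i (z : EuclideanSpace ℝ (Fin 4)), z 0 ≤ 0 → b ((σ i)⁻¹ • (z - η i)) = 0) ∧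
        ∀ z, v z = ∑' i, coef i * b ((σ i)⁻¹ • (z - η i)) := by
  -- the constants
  obtain ⟨A, hA0, hA⟩ := exists_bound_iteratedFDeriv_piece
  set K : ℝ := ∑ m ∈ Finset.range (N₁ + 1), (2 : ℝ) ^ 14 * 2 ^ m *
    ∑ i ∈ Finset.range (m + 1), (m.choose i : ℝ) * A i * (96 : ℝ) ^ (5 - (m - i)) with hKdef
  have hterm0 : ∀ m, 0 ≤ (2 : ℝ) ^ 14 * 2 ^ m *
      ∑ i ∈ Finset.range (m + 1), (m.choose i : ℝ) * A i * (96 : ℝ) ^ (5 - (m - i)) := fun m =>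
    mul_nonneg (by positivity) (Finset.sum_nonneg fun i _ =>
      mul_nonneg (mul_nonneg (Nat.cast_nonneg _) (hA0 i)) (by positivity))
  have hK0 : 0 ≤ K := Finset.sum_nonneg fun m _ => hterm0 m
  have hK : ∀ m, m ≤ N₁ → (2 : ℝ) ^ 14 * 2 ^ m *
      ∑ i ∈ Finset.range (m + 1), (m.choose i : ℝ) * A i * (96 : ℝ) ^ (5 - (m - i)) ≤ K := fun m hm =>
    Finset.single_le_sum (f := fun m => (2 : ℝ) ^ 14 * 2 ^ m *
      ∑ i ∈ Finset.range (m + 1), (m.choose i : ℝ) * A i * (96 : ℝ) ^ (5 - (m - i)))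
      (fun m _ => hterm0 m) (Finset.mem_range.2 (Nat.lt_succ_of_le hm))
  obtain ⟨hwsum, hwle⟩ := summable_weight
  -- a bound for `b`
  obtain ⟨Bb, hBb⟩ := hb.exists_bound_of_continuous b.continuous
  refine ⟨C₁ * K * (81 / 32), by positivity, fun v Mv hv hflat => ?_⟩
  -- `Mv ≥ 0`
  have hMv : 0 ≤ Mv := by
    have h := hflat 0 (Nat.zero_le _) (EuclideanSpace.single (0 : Fin 4) (1 : ℝ)) (by simp)
    simp only [PiLp.single_apply, if_true, min_self, one_pow, mul_one] at h
    exact le_trans (by positivity) h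
  have hvs : ContDiff ℝ ∞ (v : EuclideanSpace ℝ (Fin 4) → ℝ) := v.smooth ⊤
  -- the weight and the constant of a piece
  set w : PieceIdx → ℝ := fun p => spacing p.1 ^ 5 * ((1 + ‖centre p‖) ^ 14)⁻¹ with hwdef
  -- STEP 1: atoms piece by piece
  have claim : ∀ p : PieceIdx, ∃ (a : ℕ → ℝ) (σ : ℕ → ℝ) (η : ℕ → EuclideanSpace ℝ (Fin 4)),
      Summable (fun i => |a i|) ∧ ∑' i, |a i| ≤ C₁ * (K * Mv * w p) ∧
      (∀ i, 0 < σ i ∧ σ i ≤ 1 ∧ 8 * σ i ≤ η i 0) ∧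
      ∀ z, piece p z * v z = ∑' i, a i * b ((σ i)⁻¹ • (z - η i)) := by
    intro p
    have hδ := spacing_pos p.1
    have hδ64 := spacing_le p.1
    by_cases hzero : ∀ z, piece p z * v z = 0
    · -- the piece vanishes identically: the empty family
      refine ⟨fun _ => 0, fun _ => 1 / 2, fun _ => EuclideanSpace.single (0 : Fin 4) (8 : ℝ), ?_, ?_, ?_, ?_⟩
      · simp
      · simp only [abs_zero, tsum_zero]
        exact mul_nonneg hC₁ (mul_nonneg (mul_nonneg hK0 hMv)
          (mul_nonneg (pow_nonneg hδ.le 5) (by positivity)))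
      · intro i; simp only [PiLp.single_apply, if_true]; norm_num
      · intro z; simp [hzero z]
    · -- a genuine piece: single-slot synthesis at radius `2 δ_j` around the centre
      push Not at hzero
      obtain ⟨z₀, hz₀⟩ := hzero
      have hp0 : piece p z₀ ≠ 0 := fun h => hz₀ (by rw [h, zero_mul])
      have hc31 := centre_time_gt_of_piece_ne_zero hp0
      -- the Schwartz piece
      set ψ := SchwartzMap.smulLeftCLM ℝ (piece p) v with hψdef
      have hψ : (ψ : EuclideanSpace ℝ (Fin 4) → ℝ) = fun z => piece p z * v z := by
        funext z
        rw [hψdef, SchwartzMap.smulLeftCLM_apply_apply (piece_hasTemperateGrowth p), smul_eq_mul]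
      -- support
      have hsuppψ : tsupport (ψ : EuclideanSpace ℝ (Fin 4) → ℝ) ⊆
          Metric.closedBall (centre p) (3 / 2 * (2 * spacing p.1)) := by
        rw [hψ]
        intro z hz
        have hz' : z ∈ tsupport (piece p) := tsupport_mul_subset_left (f := piece p) (g := v) hz
        obtain ⟨-, -, h2, -⟩ := geometry_of_mem_tsupport_piece hz'
        rw [Metric.mem_closedBall, dist_eq_norm]; linarith
      -- derivative bounds
      have hderψ : ∀ m : ℕ, m ≤ N₁ → ∀ z, ‖iteratedFDeriv ℝ m ψ z‖ ≤ (K * Mv * w p) / (2 * spacing p.1) ^ m := by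
        intro m hm z
        rw [hψ]
        have h := norm_iteratedFDeriv_mul_flat_le (N := N₁) (piece_contDiff p) hvs (A := A) (L := 96) (K := K)
          hδ (by linarith) (by norm_num) hMv (fun i _ z => hA p i z) (centre p)
          (fun z hz => by
            obtain ⟨h1, h2, -, h4⟩ := geometry_of_mem_tsupport_piece hz
            exact ⟨h1, h2, h4⟩)
          hflat hK hm z
        simpa only [hwdef, mul_assoc] using h
      obtain ⟨a, σ, η, hsum, hle, hgeom, hrepr⟩ :=
        hslot ψ (centre p) (2 * spacing p.1) (K * Mv * w p) (by positivity) hsuppψ hderψ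
      refine ⟨a, σ, η, hsum, hle, fun i => ?_, fun z => ?_⟩
      · obtain ⟨h1, h2, h3⟩ := hgeom i
        have hη0 : |(η i - centre p) 0| ≤ ‖η i - centre p‖ := by
          have := PiLp.norm_apply_le (η i - centre p) 0; rwa [Real.norm_eq_abs] at this
        rw [PiLp.sub_apply] at hη0
        have hη0' := (abs_le.1 (hη0.trans h3)).1
        refine ⟨h1, by linarith, by linarith⟩
      · rw [← hrepr z, hψ]
  -- STEP 2: the global family on `PieceIdx × ℕ`
  choose a σ η ha_sum ha_le hσ hrepr using claim
  have hCw : Summable fun p : PieceIdx => C₁ * (K * Mv * w p) := by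
    have : (fun p : PieceIdx => C₁ * (K * Mv * w p)) = fun p => (C₁ * K * Mv) * w p := by
      funext p; ring
    rw [this]; exact hwsum.mul_left _
  have habs_summable : Summable fun q : PieceIdx × ℕ => |a q.1 q.2| := by
    refine (summable_prod_of_nonneg fun q => abs_nonneg _).2 ⟨fun p => ha_sum p, ?_⟩
    exact Summable.of_nonneg_of_le (fun p => tsum_nonneg fun i => abs_nonneg _) ha_le hCw
  have habs_tsum : ∑' q : PieceIdx × ℕ, |a q.1 q.2| ≤ C₁ * K * (81 / 32) * Mv := by
    rw [habs_summable.tsum_prod' fun p => ha_sum p]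
    calc ∑' p, ∑' i, |a p i| ≤ ∑' p, C₁ * (K * Mv * w p) :=
          Summable.tsum_le_tsum ha_le ((summable_prod_of_nonneg fun q => abs_nonneg _).1 habs_summable).2 hCw
      _ = (C₁ * K * Mv) * ∑' p, w p := by
          rw [← tsum_mul_left]; exact tsum_congr fun p => by ring
      _ ≤ (C₁ * K * Mv) * (81 / 32) := mul_le_mul_of_nonneg_left hwle (by positivity)
      _ = C₁ * K * (81 / 32) * Mv := by ring
  -- pointwise synthesis on the product index
  have hatom_bd : ∀ (q : PieceIdx × ℕ) (z : EuclideanSpace ℝ (Fin 4)),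
      ‖a q.1 q.2 * b ((σ q.1 q.2)⁻¹ • (z - η q.1 q.2))‖ ≤ |a q.1 q.2| * Bb := fun q z => by
    rw [norm_mul, Real.norm_eq_abs]
    exact mul_le_mul_of_nonneg_left (hBb _) (abs_nonneg _)
  have hpoint : ∀ z : EuclideanSpace ℝ (Fin 4),
      v z = ∑' q : PieceIdx × ℕ, a q.1 q.2 * b ((σ q.1 q.2)⁻¹ • (z - η q.1 q.2)) := by
    intro z
    have hq : Summable fun q : PieceIdx × ℕ => a q.1 q.2 * b ((σ q.1 q.2)⁻¹ • (z - η q.1 q.2)) :=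
      Summable.of_norm_bounded (habs_summable.mul_right Bb) fun q => hatom_bd q z
    rw [hq.tsum_prod' fun p => ?_]
    · -- `∑_p (piece p z * v z) = v z`
      have h1 : (fun p : PieceIdx => ∑' i, a p i * b ((σ p i)⁻¹ • (z - η p i))) =
          fun p => piece p z * v z := funext fun p => (hrepr p z).symm
      rw [h1, tsum_mul_right]
      by_cases hz : 0 < z 0
      · rw [tsum_piece hz, one_mul]
      · have hvz : v z = 0 := by
          apply image_eq_zero_of_notMem_tsupport
          exact fun h => hz (hv h)
        rw [hvz, mul_zero]
    · exact Summable.of_norm_bounded ((ha_sum p).mul_right Bb) fun i => hatom_bd (p, i) z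
  -- STEP 3: reindex by `ℕ`
  obtain ⟨_inst⟩ := nonempty_denumerable (PieceIdx × ℕ)
  let e : ℕ ≃ PieceIdx × ℕ := (Denumerable.eqv (PieceIdx × ℕ)).symm
  refine ⟨fun k => a (e k).1 (e k).2, fun k => σ (e k).1 (e k).2, fun k => η (e k).1 (e k).2,
    ?_, ?_, fun k => ⟨(hσ _ _).1, (hσ _ _).2.1⟩, fun k => (hσ _ _).2.2, fun k z hz => ?_, fun z => ?_⟩
  · exact (e.summable_iff (f := fun q : PieceIdx × ℕ => |a q.1 q.2|)).2 habs_summable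
  · rw [e.tsum_eq (fun q : PieceIdx × ℕ => |a q.1 q.2|)]
    calc ∑' q : PieceIdx × ℕ, |a q.1 q.2| ≤ C₁ * K * (81 / 32) * Mv := habs_tsum
      _ = C₁ * K * (81 / 32) * Mv := rfl
  · exact atom_eq_zero_of_nonpos b hb0 (hσ _ _).1 (hσ _ _).2.2 hz
  · rw [e.tsum_eq (fun q : PieceIdx × ℕ => a q.1 q.2 * b ((σ q.1 q.2)⁻¹ • (z - η q.1 q.2)))]
    exact hpoint z

end Summit.QuantumFields.YangMills.Theorems.RPOnsetFloorPosTimeSynth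

end
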